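import Literature.Probability.Percolation.SlabCircuitSideGlue
import HarnessLib

/-!
# Newman–Tassion–Wu 2017, Theorem 3.17 (arXiv) / 3.19 (CPAM) — a hard crossing of the hull from two
# side-to-circuit gluings (high-probability regime)

Topic: `Literature/Probability/Percolation`.  Ninth file of the circuit gluing layer.  NTW (CPAM p. 31, Fig.
3.6): "First, we use the two open paths shown in the left picture to create an open path from `B` to the
right side of `R`. Then we use the two open paths shown in the right picture to create an open path from
left to right in `R*`."  With the circuit gluing lemma both steps glue a SIDE of the hull to the minimal
circuit `Γ` of one annulus (`sideToCircuit_highProb`, `SlabCircuitSideGlue.lean`); since `Γ` is connected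
inside the annulus, the two sides are then joined inside the hull:

* `lr_of_two_glued` — `{L̄ ⟷^{W̄} Γ} ∩ {R̄ ⟷^{W̄} Γ} ⊆ {L ⟷^W R}` (deterministic).
* **`hullCrossing_highProb`** — ∀ k ε η ∃ δ: for an annulus `A_{m,n}(c)` inside a finite world `W`, two planar
  sets `Lf, Rt ⊆ W` off `B_n(c)`, sets `S₁, S₂ ⊆ W`, `X₁, X₂ ⊆ B_m(c)` and `p ∈ [ε, 1-ε]`:
  `P[𝒜_{m,n}(c)] ≥ 1-δ`, `P[X₁ ⟷^{S₁} Rt] ≥ 1-δ`, `P[X₂ ⟷^{S₂} Lf] ≥ 1-δ ⟹ P[Lf ⟷^W Rt] ≥ 1-η`.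

## Sources

* C. M. Newman, V. Tassion, W. Wu, *Critical percolation and the minimal spanning tree in slabs*,
  Comm. Pure Appl. Math. 70 (2017) = arXiv:1512.09107: Theorem 3.17 (arXiv) = 3.19 (CPAM), end of the proof
  (Fig. 3.6, "f(6c₁n, 5c₁n) ≥ h₀²(1-δ)") [NewmanTassionWu2017].
-/

noncomputable section

namespace Literature.Probability.Percolation

open MeasureTheory LatticeModels SimpleGraph

namespace NTW17

variable {k : ℕ}

/-- **Two sides glued to the same minimal circuit are joined inside the world** (the circuit is connected
inside the annulus, which lies in the world). [cite: NewmanTassionWu2017, Theorem 3.17 (end of proof)] -/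
theorem lr_of_two_glued {c : ℤ × ℤ} {m n : ℕ} {W Lf Rt : Set (ℤ × ℤ)} {hWfin : W.Finite}
    {hAW : annulus c m n ⊆ W} {hLW : Lf ⊆ W} {hRW : Rt ⊆ W} {hLfar : Disjoint Lf (sqBox c n)}
    {hRfar : Disjoint Rt (sqBox c n)} {ω : BondConfig (slab 3 k)}
    (hL : ω ∈ (CircGlue.ofConst k c m n W Lf hWfin hAW hLW hLfar).evGlued)
    (hR : ω ∈ (CircGlue.ofConst k c m n W Rt hWfin hAW hRW hRfar).evGlued) : ω ∈ slabConn k W Lf Rt := by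
  obtain ⟨a, ha, g₁, hg₁, hag⟩ := CircGlue.mem_evGlued_ofConst_iff.1 hL
  obtain ⟨b, hb, g₂, hg₂, hbg⟩ := CircGlue.mem_evGlued_ofConst_iff.1 hR
  have hH : ω ∈ circuitAround k c m n := by
    by_contra h
    have : minCircuit k ω c m n = [] := minCircuit_eq_nil h
    rw [this] at hg₁; simp at hg₁
  obtain ⟨⟨hc₁, -⟩, -⟩ := minCircuit_spec hH
  have hgg : ω ∈ openConnIn (slabLift k W) g₁ g₂ :=
    openConnIn_mono (slabLift_mono k hAW) _ _ (hc₁.openConnIn_of_mem hg₁ hg₂)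
  exact ⟨a, ha, b, hb, SlabCriticality.openConnIn_trans (SlabCriticality.openConnIn_trans hag hgg)
    (openConnIn_reverse hbg)⟩

/-- **A hard crossing of the hull, high-probability regime**: ∀ `k`, `ε > 0`, `η > 0` ∃ `δ > 0` such that for
every annulus `A_{m,n}(c)` in a finite world `W`, planar sets `Lf, Rt ⊆ W` off `B_n(c)`, `S₁, S₂ ⊆ W`,
`X₁, X₂ ⊆ B_m(c)` and `p ∈ [ε,1-ε]`: if `P[𝒜_{m,n}(c)] ≥ 1-δ`, `P[X₁ ⟷^{S₁} Rt] ≥ 1-δ`, `P[X₂ ⟷^{S₂} Lf] ≥ 1-δ`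
then `P[Lf ⟷^W Rt] ≥ 1-η`. [cite: NewmanTassionWu2017, Theorem 3.17 (proof, Fig. 3.6: f(6c₁n,5c₁n) ≥ h₀²(1-δ))] -/
theorem hullCrossing_highProb (k : ℕ) {ε : ℝ} (hε : 0 < ε) {η : ℝ} (hη : 0 < η) :
    ∃ δ : ℝ, 0 < δ ∧ ∀ (c : ℤ × ℤ) (m n : ℕ) (W Lf Rt S₁ S₂ X₁ X₂ : Set (ℤ × ℤ)) (hWfin : W.Finite)
      (hAW : annulus c m n ⊆ W) (hLW : Lf ⊆ W) (hRW : Rt ⊆ W) (hLfar : Disjoint Lf (sqBox c n))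
      (hRfar : Disjoint Rt (sqBox c n)), S₁ ⊆ W → S₂ ⊆ W → X₁ ⊆ sqBox c m → X₂ ⊆ sqBox c m →
      ∀ p : unitInterval, ε ≤ (p : ℝ) → (p : ℝ) ≤ 1 - ε →
      1 - δ ≤ (bondPercolation (slabGraph 3 k) p).real (circuitAround k c m n) →
      1 - δ ≤ (bondPercolation (slabGraph 3 k) p).real (slabConn k S₁ X₁ Rt) →
      1 - δ ≤ (bondPercolation (slabGraph 3 k) p).real (slabConn k S₂ X₂ Lf) →
      1 - η ≤ (bondPercolation (slabGraph 3 k) p).real (slabConn k W Lf Rt) := by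
  obtain ⟨δ, hδ, H⟩ := sideToCircuit_highProb k hε (half_pos hη)
  refine ⟨δ, hδ, fun c m n W Lf Rt S₁ S₂ X₁ X₂ hWfin hAW hLW hRW hLfar hRfar hS₁ hS₂ hX₁ hX₂ p hpε hp1 hA hC₁ hC₂ => ?_⟩
  set P := bondPercolation (slabGraph 3 k) p with hP
  have hR := H c m n W Rt S₁ X₁ hWfin hAW hRW hRfar hS₁ hX₁ p hpε hp1 hA hC₁
  have hL := H c m n W Lf S₂ X₂ hWfin hAW hLW hLfar hS₂ hX₂ p hpε hp1 hA hC₂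
  set EL := (CircGlue.ofConst k c m n W Lf hWfin hAW hLW hLfar).evGlued with hEL
  set ER := (CircGlue.ofConst k c m n W Rt hWfin hAW hRW hRfar).evGlued with hER
  have hsub : EL ∩ ER ⊆ slabConn k W Lf Rt := fun ω hω => lr_of_two_glued hω.1 hω.2
  -- measurability of the two glued events (determined by the pairs over the finite world)
  have hmeas : ∀ (Cs : Set (ℤ × ℤ)) (hCW : Cs ⊆ W) (hCfar : Disjoint Cs (sqBox c n)),
      MeasurableSet (CircGlue.ofConst k c m n W Cs hWfin hAW hCW hCfar).evGlued := by
    intro Cs hCW hCfar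
    classical
    set D := CircGlue.ofConst k c m n W Cs hWfin hAW hCW hCfar
    have hWfin' : (slabLift k D.W).Finite := slabLift_finite k D.hWfin
    obtain ⟨-, hdG, -⟩ := CircGlue.determinedBy_events (D := D)
    have : DeterminedBy D.evGlued ↑((finite_sym2 hWfin').toFinset) := by rw [Set.Finite.coe_toFinset]; exact hdG
    exact this.measurableSet_of_finset
  have hELm : MeasurableSet EL := hmeas Lf hLW hLfar
  have hERm : MeasurableSet ER := hmeas Rt hRW hRfar
  have hcL : P.real ELᶜ ≤ η / 2 := by rw [probReal_compl_eq_one_sub hELm]; linarith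
  have hcR : P.real ERᶜ ≤ η / 2 := by rw [probReal_compl_eq_one_sub hERm]; linarith
  have hcI : P.real (EL ∩ ER)ᶜ ≤ η := by
    rw [Set.compl_inter]; exact (measureReal_union_le _ _).trans (by linarith)
  have hI := probReal_compl_eq_one_sub (μ := P) (hELm.inter hERm)
  have h1 : 1 - η ≤ P.real (EL ∩ ER) := by linarith
  exact h1.trans (measureReal_mono hsub)

end NTW17

end Literature.Probability.Percolation

end
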